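import Mathlib.RingTheory.LocalRing.ResidueField.Basic
import Mathlib.RingTheory.Valuation.ValuationSubring
import Summits.ABC.IUTFork.Joshi.ArithHolStructureTiltModel
import HarnessLib

/-!
# The valuation ring and the RESIDUE FIELD of the tilt: `𝒪_{K♭} = (𝒪_K/p)^perf`, `k_{K♭} ≅ k_K` —
# [J-I] Prop. 4.1.7 (1) «the same residue fields» at the genuine tilt (MODEL / SUPPLY over p442777)

Block E (rung LADDER-ABC:A2.E), seat abc-iut-E-t10 (gen 4); proof/model companion of `ArithHolStructure.lean` (p431050→p437040;
[J-I] = Joshi, arXiv:2106.11452v4, Def. 4.1.1 / Prop. 4.1.7), `ArithHolStructureTilt.lean` (p433682→p437482) and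
`ArithHolStructureTiltModel.lean` (p442777: the normed field `(K♭, |·|_♭)` = `TiltModel.normedFieldTilt U` on Mathlib's `Tilt`, with
`|x|_♭ = |x^♯|_K`, and Prop. 4.1.7 (1)'s VALUE-GROUP clause unconditional at `F = K♭`). p442777's hand-off named the next discharge:
Prop. 4.1.7 (1) p.19 l.29–30 «… the same residue fields … as that of F», typed in p431050 as the claim-def
`ArithHolStructure.SameResidueField S := Nonempty (k(𝒪_K) ≃+* k(𝒪_F))` over Mathlib's `IsLocalRing.ResidueField` of the valuation
subrings of `‖·‖`. THIS FILE SUPPLIES IT. For every untilt `K` (E-t1's `Untilt p`) we PROVE, hypothesis-free, from Mathlib's `PreTilt` /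
`Perfection.quotientMulEquiv` / `teichmuller₀` and p442777's `flatInt`/`flatFr`/`valFr`:
* `dvd_of_valInt_le`: in `𝒪_{K♭} := PreTilt 𝒪_K p`, `|a|_♭ ≤ |s|_♭ ≠ 0 ⟹ s ∣ a` (divide the Teichmüller towers coordinatewise);
  `isUnit_iff_valInt_eq_one`;
* `integers_valFr` / `integers_normedFieldFr`: **`𝒪_{K♭}` IS the valuation ring of `(K♭, |·|_♭)`** (`Valuation.Integers`), i.e.
  `{z ∈ K♭ : |z|_♭ ≤ 1} = (𝒪_K/p)^perf` ([Scholze 2012, Lem. 3.4]: `K♭ = Frac 𝒪_{K♭}`, `𝒪_{K♭}` a complete valuation ring of rank 1);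
* `residueInt : 𝒪_{K♭} →+* k_K`, `f ↦ (f^♯ mod 𝔪_K) = (f_0 mod 𝔪_K/p)` — a RING map (degree-`0` coefficient, then `𝒪_K/p ↠ 𝒪_K/𝔪_K`),
  SURJECTIVE (`residueInt_surjective`: lift, take a `p`-power-root tower, reduce) with KERNEL `{|f|_♭ < 1}` (`residueInt_eq_zero_iff`);
* `residueFieldEquivFr` / **`residueFieldTiltEquiv U : k(𝒪_{K♭}) ≃+* k(𝒪_K)`** on `ATS1.tilt U` with the norm `normedFieldTilt U` —
  so **`sameResidueField_tilt`: [J-I] Prop. 4.1.7 (1) «the same residue fields» HOLDS UNCONDITIONALLY for `K` and `F = K♭`**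
  ([Scholze 2012, Lem. 3.4 and its proof: `𝒪_{K♭}/ϖ♭ = 𝒪_K/ϖ`], whence equal residue fields);
* `valuationSubringEquivOfIsometry` + **`ArithHolStructure.sameResidueField_of_isometry`**: for an arithmetic holomorphic structure `S`
  over ANY tilt base `F` together with an ISOMETRIC field isomorphism `ι : (K♭, |·|_♭) ≃ F` — Joshi's untilt datum «with an isometry
  K♭ ≃ F» ([J-I] §3.5 p.9 l.38–40; Def. 4.1.1 (1) p.18 l.11ff; cf. [J-IIp] §2.6 «an isometry ι : K♭ ≃ F») read on the VALUED FIELD —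
  p431050's claim-def `S.SameResidueField` HOLDS (`k_K ≅ k_{K♭} ≅ k_F`). DISCHARGED modulo that isometry; our kernel check of the
  typed clause, not an endorsement of the preprint.
HONEST SCOPE. p431050's `ArithHolStructure` records the tilt datum as a bare field iso `tiltIso : K♭ ≃+* F` plus a multiplicative
isometry `sharp : F →*₀ K` NOT tied to `tiltIso` (its reading note (e)); from that signature ALONE `SameResidueField` does not follow
(the norm of `F` is not determined by the abstract field `F ≅ K♭`), which is why the isometry of `ι` is an explicit hypothesis here —
it is exactly print's datum. Non-vacuity of `ArithHolStructure X A (tilt U)` itself still needs `IsAlgClosed`/`CompleteSpace` on the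
tilt (not built; recorded in p431050 (f)). All [folklore]; no claim of Joshi's used as a hypothesis or asserted; no `Prop` hypothesis,
instance, notation or FACT-LIST row introduced. A model exhibits satisfiability, nothing more; no side taken on [IUTchIII] Cor. 3.12 or
on any author. bears_on: LADDER-ABC:A2.E.
-/

noncomputable section

open scoped NNReal

namespace Summit.ABC.IUTFork.Joshi.ATS1

open Summit.ABC.IUTFork.Joshi

variable {p : ℕ} [Fact p.Prime]

namespace TiltModel

/-! ## 0. The valuation subring `𝒪_L ⊂ L` of a normed field and its residue field `k(𝒪_L)` (the spelling of `SameResidueField`) -/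

/-- `𝒪_L := {‖x‖ ≤ 1}` as Mathlib's `ValuationSubring` of `‖·‖₊` — the ring whose `IsLocalRing.ResidueField` p431050's `SameResidueField`
compares. [folklore] -/
abbrev vsub (L : Type) [NormedField L] [IsUltrametricDist L] : ValuationSubring L :=
  (NormedField.valuation (K := L)).valuationSubring

/-- `x ∈ 𝒪_L ⟺ ‖x‖ ≤ 1`. [folklore] -/
theorem mem_vsub_iff {L : Type} [NormedField L] [IsUltrametricDist L] {x : L} : x ∈ vsub L ↔ ‖x‖ ≤ 1 := by
  rw [Valuation.mem_valuationSubring_iff, NormedField.valuation_apply, ← NNReal.coe_le_coe, coe_nnnorm, NNReal.coe_one]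

/-- `x ∈ 𝔪_L ⟺ ‖x‖ < 1` for `x ∈ 𝒪_L`. [folklore] -/
theorem mem_maximalIdeal_vsub_iff {L : Type} [NormedField L] [IsUltrametricDist L] {x : vsub L} :
    x ∈ IsLocalRing.maximalIdeal (vsub L) ↔ ‖(x : L)‖ < 1 := by
  rw [Valuation.mem_maximalIdeal_iff, NormedField.valuation_apply, ← NNReal.coe_lt_coe, coe_nnnorm, NNReal.coe_one]

/-- **An ISOMETRIC field isomorphism restricts to the valuation rings**: `ι : L ≃ F`, `‖ι y‖ = ‖y‖` gives `𝒪_L ≃+* 𝒪_F`. [folklore] -/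
def valuationSubringEquivOfIsometry {L F : Type} [NormedField L] [IsUltrametricDist L] [NormedField F] [IsUltrametricDist F]
    (ι : L ≃+* F) (hι : ∀ y, ‖ι y‖ = ‖y‖) : vsub L ≃+* vsub F where
  toFun x := ⟨ι (x : L), mem_vsub_iff.2 (by rw [hι]; exact mem_vsub_iff.1 x.2)⟩
  invFun y := ⟨ι.symm (y : F), mem_vsub_iff.2 (by rw [← hι, RingEquiv.apply_symm_apply]; exact mem_vsub_iff.1 y.2)⟩
  left_inv x := Subtype.ext (ι.symm_apply_apply (x : L))
  right_inv y := Subtype.ext (ι.apply_symm_apply (y : F))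
  map_mul' x y := Subtype.ext (map_mul ι (x : L) (y : L))
  map_add' x y := Subtype.ext (map_add ι (x : L) (y : L))

/-- … hence ISOMETRIC normed fields have isomorphic residue fields `k(𝒪_L) ≃+* k(𝒪_F)`. [folklore] -/
def residueFieldEquivOfIsometry {L F : Type} [NormedField L] [IsUltrametricDist L] [NormedField F] [IsUltrametricDist F]
    (ι : L ≃+* F) (hι : ∀ y, ‖ι y‖ = ‖y‖) : IsLocalRing.ResidueField (vsub L) ≃+* IsLocalRing.ResidueField (vsub F) :=
  IsLocalRing.ResidueField.mapEquiv (valuationSubringEquivOfIsometry ι hι)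

/-- `𝒪_K` of an untilt in p431050's spelling `int U = ‖·‖.integer` IS `vsub K` — the identity on carriers, as a ring isomorphism. [folklore] -/
def intEquiv (U : Untilt p) : int U ≃+* vsub U.K where
  toFun x := ⟨x.1, mem_vsub_iff.2 ((mem_int_iff U).1 x.2)⟩
  invFun x := ⟨x.1, (mem_int_iff U).2 (mem_vsub_iff.1 x.2)⟩
  left_inv _ := rfl
  right_inv _ := rfl
  map_mul' _ _ := rfl
  map_add' _ _ := rfl

/-! ## 1. `𝒪_K/p ↠ k_K`; divisibility in `𝒪_{K♭} = (𝒪_K/p)^perf` from norms; units -/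

/-- `𝒪_K/p → 𝒪_K/𝔪_K = k_K` (`p ∈ 𝔪_K` as `‖p‖ < 1`). [folklore] -/
def modPToResidue (U : Untilt p) : ModP (int U) p →+* IsLocalRing.ResidueField (vsub U.K) :=
  Ideal.Quotient.lift (Ideal.span {((p : ℕ) : int U)}) ((IsLocalRing.residue (vsub U.K)).comp (intEquiv U).toRingHom)
    (fun a ha => by
      obtain ⟨c, rfl⟩ := Ideal.mem_span_singleton'.1 ha
      have hp : IsLocalRing.residue (vsub U.K) (intEquiv U ((p : ℕ) : int U)) = 0 :=
        (IsLocalRing.residue_eq_zero_iff _).2 (mem_maximalIdeal_vsub_iff.2 (by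
          rw [show ((intEquiv U ((p : ℕ) : int U) : vsub U.K) : U.K) = ((p : ℕ) : U.K) from map_natCast (int U).subtype p]
          exact U.norm_p_lt_one))
      change IsLocalRing.residue (vsub U.K) (intEquiv U (c * ((p : ℕ) : int U))) = 0
      rw [map_mul, map_mul, hp, mul_zero])

/-- `modPToResidue (a mod p) = a mod 𝔪_K`. [folklore] -/
theorem modPToResidue_mk (U : Untilt p) (a : int U) :
    modPToResidue U (Ideal.Quotient.mk _ a) = IsLocalRing.residue (vsub U.K) (intEquiv U a) :=
  Ideal.Quotient.lift_mk _ _ _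

/-! ### divisibility and units in `𝒪_{K♭}` -/

/-- `lim 𝒪_K → (ℕ → K)` is injective. [folklore] -/
theorem perfSeq_injective (U : Untilt p) : Function.Injective (perfSeq U) := fun _ _ h =>
  Perfection.extMonoid fun n => Subtype.ext (congrFun h n)

section Integral

variable (U : Untilt p) [Fact (¬ IsUnit ((p : ℕ) : int U))] [IsAdicComplete (Ideal.span {((p : ℕ) : int U)}) (int U)]

/-- `x ↦ (x^{♯ 1/pⁿ})_n` is INJECTIVE on `𝒪_{K♭}` (Teichmüller iso, then `perfSeq`). [folklore] -/
theorem flatInt_injective : Function.Injective (flatInt U) := fun _ _ h =>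
  (Perfection.quotientMulEquiv p (Ideal.span {((p : ℕ) : int U)})).symm.injective (perfSeq_injective U h)

/-- `|f|_♭ ≤ 1` on `𝒪_{K♭}`. [folklore] -/
theorem valInt_le_one (f : PreTilt (int U) p) : valInt U f ≤ 1 := by
  rw [valInt_eq_nnnorm, flatInt_apply_zero, ← NNReal.coe_le_coe, coe_nnnorm, NNReal.coe_one]
  exact norm_coe_le_one _

/-- **Divisibility from norms in `𝒪_{K♭}`**: `s ≠ 0`, `|a|_♭ ≤ |s|_♭ ⟹ s ∣ a` — the quotient of the Teichmüller towers
`(a^{♯1/pⁿ}/s^{♯1/pⁿ})_n` is an integral compatible sequence, i.e. an element of `𝒪_{K♭}`. PROVED. [folklore] -/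
theorem dvd_of_valInt_le {a s : PreTilt (int U) p} (hs : s ≠ 0) (h : valInt U a ≤ valInt U s) : s ∣ a := by
  have hx : flatInt U a * (flatInt U s)⁻¹ ∈ powerCompatSeq U :=
    (powerCompatSeq U).mul_mem (flatInt_mem U a) (inv_mem (flatInt_mem U s))
  have hs0 : ∀ n, flatInt U s n ≠ 0 := flatInt_apply_ne_zero U hs
  have h' : ‖flatInt U a 0‖ ≤ ‖flatInt U s 0‖ := by
    rw [valInt_eq_nnnorm, valInt_eq_nnnorm] at h
    exact_mod_cast h
  have h0 : ‖(flatInt U a * (flatInt U s)⁻¹) 0‖ ≤ 1 := by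
    rw [Pi.mul_apply, Pi.inv_apply, norm_mul, norm_inv, ← div_eq_mul_inv, div_le_one (norm_pos_iff.2 (hs0 0))]
    exact h'
  refine ⟨ofSeq U _ hx h0, flatInt_injective U ?_⟩
  rw [map_mul, flatInt_ofSeq]
  funext n
  rw [Pi.mul_apply, Pi.mul_apply, Pi.inv_apply, mul_comm (flatInt U a n), ← mul_assoc, mul_inv_cancel₀ (hs0 n), one_mul]

omit [IsAdicComplete (Ideal.span {((p : ℕ) : int U)}) (int U)] in
/-- `|f|_♭ ≠ 0` for `f ≠ 0`. [folklore] -/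
theorem valInt_ne_zero {f : PreTilt (int U) p} (hf : f ≠ 0) : valInt U f ≠ 0 := fun h => hf ((PreTilt.map_eq_zero _).1 h)

/-- **Units of `𝒪_{K♭}`** are exactly the elements of valuation `1`. PROVED. [folklore] -/
theorem isUnit_iff_valInt_eq_one (f : PreTilt (int U) p) : IsUnit f ↔ valInt U f = 1 := by
  constructor
  · rintro ⟨u, rfl⟩
    refine le_antisymm (valInt_le_one U _) ?_
    have h1 : valInt U (u : PreTilt (int U) p) * valInt U (↑u⁻¹ : PreTilt (int U) p) = 1 := by
      rw [← map_mul, Units.mul_inv, map_one]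
    calc (1 : ℝ≥0) = valInt U (u : PreTilt (int U) p) * valInt U (↑u⁻¹ : PreTilt (int U) p) := h1.symm
      _ ≤ valInt U (u : PreTilt (int U) p) := mul_le_of_le_one_right' (valInt_le_one U _)
  · intro h
    have hf : f ≠ 0 := fun h0 => zero_ne_one (by rw [← h, h0, map_zero])
    exact isUnit_of_dvd_one (dvd_of_valInt_le U hf (by rw [h, map_one]))

/-! ## 2. The residue map `𝒪_{K♭} → k_K`, `f ↦ f^♯ mod 𝔪_K = f_0 mod (𝔪_K/p)` -/

/-- **The residue map `𝒪_{K♭} →+* k_K`**: degree-`0` coefficient `𝒪_{K♭} = (𝒪_K/p)^perf → 𝒪_K/p`, then `𝒪_K/p ↠ k_K`. A RING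
homomorphism ([Scholze 2012, proof of Lem. 3.4: `𝒪_{K♭} → 𝒪_K/ϖ` is the projection of the inverse limit]). [folklore] -/
def residueInt : PreTilt (int U) p →+* IsLocalRing.ResidueField (vsub U.K) := (modPToResidue U).comp (PreTilt.coeff 0)

/-- `residueInt f = f^♯ mod 𝔪_K` with `f^♯ = teichmuller₀ f` (Mathlib's `mk_teichmuller₀ : f^♯ mod p = f_0`). [folklore] -/
theorem residueInt_eq_residue_teichmuller (f : PreTilt (int U) p) :
    residueInt U f = IsLocalRing.residue (vsub U.K)
      (intEquiv U (Perfection.teichmuller₀ p (Ideal.span {((p : ℕ) : int U)}) f)) := by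
  rw [← modPToResidue_mk, Perfection.mk_teichmuller₀]; rfl

/-- **Kernel**: `residueInt f = 0 ⟺ |f|_♭ < 1` (`|f|_♭ = ‖f^♯‖_K`, p442777's `valInt_eq_nnnorm`). PROVED. [folklore] -/
theorem residueInt_eq_zero_iff (f : PreTilt (int U) p) : residueInt U f = 0 ↔ valInt U f < 1 := by
  rw [residueInt_eq_residue_teichmuller, IsLocalRing.residue_eq_zero_iff, mem_maximalIdeal_vsub_iff, valInt_eq_nnnorm,
    flatInt_apply_zero, ← NNReal.coe_lt_coe, coe_nnnorm, NNReal.coe_one]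
  rfl

/-- `residueInt` on a reduced tower `ofSeq x` is `x_0 mod 𝔪_K`. [folklore] -/
theorem residueInt_ofSeq (x : ℕ → U.K) (hx : x ∈ powerCompatSeq U) (h0 : ‖x 0‖ ≤ 1) :
    residueInt U (ofSeq U x hx h0) = IsLocalRing.residue (vsub U.K) ⟨x 0, mem_vsub_iff.2 h0⟩ := by
  change modPToResidue U (PreTilt.coeff 0 (Perfection.quotientMulEquiv p (Ideal.span {((p : ℕ) : int U)}) (toPerfection U x hx h0))) = _
  rw [PreTilt.coeff_def, Perfection.coeff_quotientMulEquiv, modPToResidue_mk]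
  rfl

/-- **`residueInt` is SURJECTIVE**: `r = a mod 𝔪_K`; `a` heads a `p`-power-root tower `x` (algebraic closedness,
`exists_powerCompatSeq_head`); `ofSeq x ↦ r`. PROVED. [folklore] -/
theorem residueInt_surjective : Function.Surjective (residueInt U) := fun r => by
  obtain ⟨a, rfl⟩ := IsLocalRing.residue_surjective r
  obtain ⟨x, hx, hx0⟩ := exists_powerCompatSeq_head U (a : U.K)
  have h0 : ‖x 0‖ ≤ 1 := by rw [hx0]; exact mem_vsub_iff.1 a.2
  refine ⟨ofSeq U x hx h0, ?_⟩
  rw [residueInt_ofSeq]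
  congr 1
  exact Subtype.ext hx0

end Integral

/-! ## 3. `𝒪_{K♭}` is the valuation ring of `(K♭, |·|_♭)`; the residue field `k(𝒪_{K♭}) ≃+* k(𝒪_K)` -/

section Frac

variable (U : Untilt p) [Fact (¬ IsUnit ((p : ℕ) : int U))] [IsDomain (PreTilt (int U) p)]
  [IsAdicComplete (Ideal.span {((p : ℕ) : int U)}) (int U)]

/-- **`𝒪_{K♭} = (𝒪_K/p)^perf` IS THE VALUATION RING of `|·|_♭` on `K♭ = Frac 𝒪_{K♭}`** (Mathlib's `Valuation.Integers`): injective,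
values `≤ 1`, and every `z = a/s` with `|z|_♭ ≤ 1` is integral (`dvd_of_valInt_le`). [Scholze 2012, Lem. 3.4]. PROVED. [folklore] -/
theorem integers_valFr : (valFr U).Integers (PreTilt (int U) p) where
  hom_inj := IsFractionRing.injective _ _
  map_le_one a := by rw [valFr_algebraMap]; exact valInt_le_one U a
  exists_of_le_one := by
    intro z hz
    obtain ⟨⟨a, s⟩, rfl⟩ := IsLocalization.mk'_surjective (nonZeroDivisors (PreTilt (int U) p)) z
    have hs : (s : PreTilt (int U) p) ≠ 0 := nonZeroDivisors.coe_ne_zero s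
    have hle : valInt U a ≤ valInt U s := by
      have hz' : valInt U a * (valInt U s)⁻¹ ≤ 1 := by rwa [valFr_mk'] at hz
      rwa [mul_inv_le_iff₀ (pos_iff_ne_zero.2 (valInt_ne_zero U hs)), one_mul] at hz'
    obtain ⟨c, hc⟩ := dvd_of_valInt_le U hs hle
    refine ⟨c, ?_⟩
    rw [IsLocalization.eq_mk'_iff_mul_eq, ← map_mul, hc, mul_comm]

/-- **`‖·‖_♭` is ULTRAMETRIC** (`|x + y|_♭ ≤ max |x|_♭ |y|_♭`, a valuation): the `IsUltrametricDist` structure of `(K♭, ‖·‖_♭)` as an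
explicit term (needed to speak of Mathlib's `NormedField.valuation` / the valuation subring of the tilt). PROVED. [folklore] -/
theorem isUltrametricDist_Fr : letI := normedFieldFr U; IsUltrametricDist (tiltFr U) := by
  letI := normedFieldFr U
  refine IsUltrametricDist.isUltrametricDist_of_forall_norm_add_le_max_norm fun x y => ?_
  rw [norm_eq_valFr U (x + y), norm_eq_valFr U x, norm_eq_valFr U y]
  exact_mod_cast (valFr U).map_add x y

/-- Under `normedFieldFr U` the valuation `‖·‖₊` of `K♭` IS `|·|_♭`, pointwise … [folklore] -/
theorem valuationFr_apply (z : tiltFr U) :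
    (letI := normedFieldFr U; haveI := isUltrametricDist_Fr U; NormedField.valuation (K := tiltFr U) z) = valFr U z := by
  letI := normedFieldFr U
  haveI := isUltrametricDist_Fr U
  apply NNReal.eq
  rw [NormedField.valuation_apply, coe_nnnorm]
  exact norm_eq_valFr U z

/-- … and as valuations. [folklore] -/
theorem valuation_eq_valFr :
    (letI := normedFieldFr U; haveI := isUltrametricDist_Fr U; NormedField.valuation (K := tiltFr U)) = valFr U :=
  Valuation.ext (valuationFr_apply U)

/-- … so `𝒪_{K♭}` is the valuation ring of `(K♭, ‖·‖_♭)` in the normed-field spelling. [folklore] -/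
theorem integers_normedFieldFr :
    letI := normedFieldFr U; haveI := isUltrametricDist_Fr U; (NormedField.valuation (K := tiltFr U)).Integers (PreTilt (int U) p) := by
  rw [valuation_eq_valFr]
  exact integers_valFr U

/-- `𝒪_{K♭}` in the spelling of `SameResidueField`: the valuation subring of `(K♭, ‖·‖_♭)`. [folklore] -/
abbrev vsubFr : ValuationSubring (tiltFr U) := letI := normedFieldFr U; haveI := isUltrametricDist_Fr U; vsub (tiltFr U)

/-- **`(𝒪_K/p)^perf ≃+* 𝒪_{K♭}`** (onto the valuation subring of `(K♭, ‖·‖_♭)`). CONSTRUCTED. [folklore] -/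
def intTiltEquiv : PreTilt (int U) p ≃+* vsubFr U :=
  RingEquiv.ofBijective ((algebraMap (PreTilt (int U) p) (tiltFr U)).codRestrict (vsubFr U)
      (fun a => (Valuation.mem_valuationSubring_iff _ _).2 ((integers_normedFieldFr U).map_le_one a)))
    ⟨fun a b h => (integers_normedFieldFr U).hom_inj (congrArg Subtype.val h), fun z => by
      obtain ⟨a, ha⟩ := (integers_normedFieldFr U).exists_of_le_one ((Valuation.mem_valuationSubring_iff _ _).1 z.2)
      exact ⟨a, Subtype.ext ha⟩⟩

/-- `intTiltEquiv a = a/1`. [folklore] -/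
theorem coe_intTiltEquiv (a : PreTilt (int U) p) : ((intTiltEquiv U a : vsubFr U) : tiltFr U) = algebraMap _ (tiltFr U) a := rfl

/-- `‖z‖_♭ = |intTiltEquiv⁻¹ z|_♭` for `z ∈ 𝒪_{K♭}`. [folklore] -/
theorem valFr_coe_eq_valInt_symm (z : vsubFr U) : valFr U (z : tiltFr U) = valInt U ((intTiltEquiv U).symm z) := by
  conv_lhs => rw [← (intTiltEquiv U).apply_symm_apply z, coe_intTiltEquiv]
  exact valFr_algebraMap U _

/-- **The residue map of the tilt, `𝒪_{K♭} →+* k(𝒪_K)`** (`residueInt` through `intTiltEquiv`). [folklore] -/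
def residueFr : vsubFr U →+* IsLocalRing.ResidueField (vsub U.K) := (residueInt U).comp (intTiltEquiv U).symm.toRingHom

/-- `residueFr` is surjective. [folklore] -/
theorem residueFr_surjective : Function.Surjective (residueFr U) :=
  (residueInt_surjective U).comp (intTiltEquiv U).symm.surjective

/-- **`ker (𝒪_{K♭} → k_K) = 𝔪_{K♭}`**. PROVED. [folklore] -/
theorem ker_residueFr : RingHom.ker (residueFr U) = IsLocalRing.maximalIdeal (vsubFr U) := by
  ext z
  rw [RingHom.mem_ker, Valuation.mem_maximalIdeal_iff, valuationFr_apply, valFr_coe_eq_valInt_symm, ← residueInt_eq_zero_iff]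
  rfl

/-- **`k(𝒪_{K♭}) ≃+* k(𝒪_K)`** (fraction-field presentation): `𝒪_{K♭}/𝔪_{K♭} = 𝒪_{K♭}/ker ≅ k_K`. CONSTRUCTED. [folklore] -/
def residueFieldEquivFr : IsLocalRing.ResidueField (vsubFr U) ≃+* IsLocalRing.ResidueField (vsub U.K) :=
  (Ideal.quotEquivOfEq (ker_residueFr U).symm).trans (RingHom.quotientKerEquivOfSurjective (residueFr_surjective U))

end Frac

/-! ## 4. On `ATS1.tilt U` with `normedFieldTilt U`, hypothesis-free; Prop. 4.1.7 (1) «same residue fields» -/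

/-- `‖·‖_♭` on `ATS1.tilt U` (`normedFieldTilt U`) is ultrametric — explicit term, no hypotheses. [folklore] -/
theorem isUltrametricDist_tilt (U : Untilt p) : letI := normedFieldTilt U; IsUltrametricDist (tilt U) :=
  haveI : Fact (¬ IsUnit ((p : ℕ) : int U)) := ⟨not_isUnit_p U⟩
  haveI : IsDomain (PreTilt (int U) p) := isDomain_preTilt U
  haveI : IsAdicComplete (Ideal.span {((p : ℕ) : int U)}) (int U) := isAdicComplete_int U
  isUltrametricDist_Fr U

/-- **`k(𝒪_{K♭}) ≃+* k(𝒪_K)` ON THE TILT ITSELF** — the residue field of the valuation ring of `(ATS1.tilt U, ‖·‖_♭ = normedFieldTilt U)`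
is that of `K`, for every untilt, no hypotheses ([Scholze 2012, Lem. 3.4]: `𝒪_{K♭}/ϖ♭ ≅ 𝒪_K/ϖ`). CONSTRUCTED. [folklore] -/
def residueFieldTiltEquiv (U : Untilt p) :
    letI := normedFieldTilt U
    haveI := isUltrametricDist_tilt U
    IsLocalRing.ResidueField (vsub (tilt U)) ≃+* IsLocalRing.ResidueField (vsub U.K) :=
  haveI : Fact (¬ IsUnit ((p : ℕ) : int U)) := ⟨not_isUnit_p U⟩
  haveI : IsDomain (PreTilt (int U) p) := isDomain_preTilt U
  haveI : IsAdicComplete (Ideal.span {((p : ℕ) : int U)}) (int U) := isAdicComplete_int U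
  residueFieldEquivFr U

/-- **[J-I] Prop. 4.1.7 (1) «… the same residue fields … as that of F» for `K` and ITS OWN TILT `F = (K♭, ‖·‖_♭)` — UNCONDITIONAL**,
in exactly the shape of p431050's `SameResidueField` (`Nonempty (k(𝒪_K) ≃+* k(𝒪_F))`). PROVED. [folklore] -/
theorem sameResidueField_tilt (U : Untilt p) :
    letI := normedFieldTilt U
    haveI := isUltrametricDist_tilt U
    Nonempty (IsLocalRing.ResidueField (vsub U.K) ≃+* IsLocalRing.ResidueField (vsub (tilt U))) :=
  ⟨(residueFieldTiltEquiv U).symm⟩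

end TiltModel

/-! ## 5. Consequence for p431050's `ArithHolStructure`: `SameResidueField` modulo the ISOMETRIC tilt identification -/

namespace ArithHolStructure

open TiltModel

variable {X : Literature.AnabelianGeometry.SemiGraphs.TemperedCurve p} {A : BerkovichDatum X} {F : Type} [NormedField F]
  [CompleteSpace F] [IsUltrametricDist F] [IsAlgClosed F] [CharP F p]

/-- **[J-I] Prop. 4.1.7 (1) «the same residue fields» DISCHARGED modulo the isometric tilt datum**: if the untilt `K` of `S` comes
with a field isomorphism `ι : K♭ ≃ F` that is an ISOMETRY for `‖·‖_♭` (`|x|_♭ = |x^♯|_K`, p442777) — Joshi's «with an isometry K♭ ≃ F»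
([J-I] §3.5 p.9 l.38–40, Def. 4.1.1 (1)) read on the valued field — then p431050's claim-def `S.SameResidueField` HOLDS:
`k_K ≅ k_{K♭} ≅ k_F`. Our kernel check of the typed clause; not an endorsement of the preprint. [claim: Joshi2021ATS1, status: disputed] -/
theorem sameResidueField_of_isometry (S : ArithHolStructure X A F) (ι : tilt S.U ≃+* F)
    (hι : ∀ y, ‖ι y‖ = (letI := normedFieldTilt S.U; ‖y‖)) : S.SameResidueField :=
  letI := normedFieldTilt S.U
  haveI := isUltrametricDist_tilt S.U
  ⟨(residueFieldTiltEquiv S.U).symm.trans (residueFieldEquivOfIsometry ι hι)⟩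

/-- In particular when the structure's OWN tilting datum `S.tiltIso : K♭ ≃+* F` is an isometry for `‖·‖_♭`. [claim: Joshi2021ATS1, status: disputed] -/
theorem sameResidueField_of_tiltIso_isometry (S : ArithHolStructure X A F)
    (h : ∀ y, ‖S.tiltIso y‖ = (letI := normedFieldTilt S.U; ‖y‖)) : S.SameResidueField :=
  sameResidueField_of_isometry S S.tiltIso h

/-- … and for structures assembled from a tilt-monoid datum (`ofTiltMonoidDatum`, p433682) with an isometric `ι`, BOTH Prop. 4.1.7 (1)
clauses typed concretely in p431050 — value groups AND residue fields — hold together. [claim: Joshi2021ATS1, status: disputed] -/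
theorem sameValueGroup_and_sameResidueField (U : Untilt p) (emb : X.K →+* U.K)
    (h : Continuous fun x : ℚ_[p] => emb (algebraMap ℚ_[p] X.K x)) (ι : tilt U ≃+* F)
    (hι : ∀ y, ‖ι y‖ = (letI := normedFieldTilt U; ‖y‖)) (T : TiltMonoidDatum U F) (b : A.BasePt U emb) :
    (ofTiltMonoidDatum U emb h ι T b).SameValueGroup ∧ (ofTiltMonoidDatum U emb h ι T b).SameResidueField :=
  ⟨sameValueGroup_ofTiltMonoidDatum U emb h ι T b, sameResidueField_of_isometry _ ι hι⟩

end ArithHolStructure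

end Summit.ABC.IUTFork.Joshi.ATS1

end
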